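import Mathlib
import Summits.ValiantsHypothesis.ValiantsHypothesis.Cruxes.OrbitDimensionBound.Lines.RowTorusLadder

/-!
# F4 ON-PATH file for the rung `RowTorus.RowShadow` (line `row_torus`)

`S → Rung`: `VP_ℂ ≠ VNP_ℂ` implies the rung (one line: `1 ≤ 2^{rk Λ_R}` and `coveringShadow_of_summit`), so closing the
rung is NECESSARY for the summit; and the kernel's own portfolio tactic (`intro h; aesop`) closes it (the lemma is tagged
`@[aesop safe apply]` in the ladder file).  Also recorded: the rung feeds the host route's closing (`closes_rung`) and the
relaxed closing `closes_oneSided`. [cite: LandsbergRessayre2017, Question 2.2]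
-/

set_option linter.dupNamespace false

namespace Summit.ValiantsHypothesis.ValiantsHypothesis.Cruxes.OrbitDimensionBound.RowTorus.OnPath

open Summit.ValiantsHypothesis.ValiantsHypothesis.Cruxes.OrbitDimensionBound.RowTorus

/-- `S → Rung`. [cite: LandsbergRessayre2017, Question 2.2] -/
theorem rung_of_summit : _root_.ValiantsHypothesis → RowShadow :=
  rowShadow_of_summit

/-- The kernel's portfolio closes `S → Rung`. [cite: LandsbergRessayre2017, Question 2.2] -/
example : _root_.ValiantsHypothesis → RowShadow := by
  intro h; aesop

/-- The rung's numeric member closes the host route with the ORIGINAL crux. [cite: LandsbergRessayre2017, Thm. 2.8] -/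
example (h₁ : Summit.ValiantsHypothesis.ValiantsHypothesis.Theses.FreeSubtorus.OrbitDimensionBound)
    (h₂ : RowRankCovering) : _root_.ValiantsHypothesis :=
  closes_rung h₁ h₂

/-- … and the line's hub statement closes it with the RELAXED crux. [cite: LandsbergRessayre2017, Question 2.2] -/
example (h₁ : OrbitRowBound) (h₂ : OneSidedRowCovering) : _root_.ValiantsHypothesis :=
  closes_oneSided h₁ h₂

end Summit.ValiantsHypothesis.ValiantsHypothesis.Cruxes.OrbitDimensionBound.RowTorus.OnPath
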